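import Summits.FinalStateConjecture.FinalStateConjecture.Theorems.EIHFluxBalanceInertialRecessionStubRechartLeibniz
import Summits.FinalStateConjecture.FinalStateConjecture.Theorems.EIHFluxBalanceInertialRecessionStubRechartTransportLaw
import Summits.FinalStateConjecture.FinalStateConjecture.Theorems.EIHFluxBalanceInertialRecessionLorentz

/-!
# Route EIHFluxBalance — `InertialRecession`, re-charting: untwisting the painted frame of a
# rotating hole — decay of all derivatives of the stabiliser-free frame

Helper file for the crux `stmt-FinalStateConjecture-10166`
(`Summit.FinalStateConjecture.FinalStateConjecture.Theses.EIHFluxBalance.InertialRecession`),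
line `sublinear-is-free-clean-window-charges`, stub `stub_rechart` (the transfer P2, reshape r6).

Assembly of `exists_untwisting_angle'` (file `…StubRechartTransportLaw`: `Λ̃ = Λ·R_θ` smooth,
same `e₀`, `e₃` columns, transport laws for the `e₁`, `e₂` columns) with the transport-decay lemma
`tendsto_iteratedDeriv_of_transport'` and the column bound
`tendsto_iteratedDeriv_clm_zero_of_columns` (file `…StubRechartLeibniz`): if the derivatives of
orders `1 … k` of `u = Λe₀` and `s = Λe₃` tend to `0` (third-order slaving gives `k = 3`) and the
Lorentz factor is bounded, then ALL derivatives of orders `1 … k` of `Λ̃` tend to `0` in operator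
norm (`exists_untwisted_frame'`, registered one-line form unprimed). This is the frame
normalisation of a ROTATING hole that both the hole charts and the flat-chart estimate consume
(the non-rotating case is the pure boost of the lab velocity, file `…SchwarzschildFrame`).
[folklore]
-/

noncomputable section

set_option linter.dupNamespace false

open Set Filter Function Topology Literature.Geometry.Lorentzian
open Summit.FinalStateConjecture.FinalStateConjecture.Theorems
open Summit.FinalStateConjecture.FinalStateConjecture.Theorems.InertialRecession.Negative
open scoped ContDiff

namespace Summit.FinalStateConjecture.FinalStateConjecture.Theorems.SublinearIsFree.Rechart

/-- **Untwisting a painted frame: decay of all derivatives.** See the module docstring.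
[folklore] -/
theorem exists_untwisted_frame' (Λ : ℝ → lorentzGroup) (γ : ℝ) (k : ℕ)
    (hΛ : ContDiff ℝ ∞ (fun t ↦ ((Λ t : E4 ≃L[ℝ] E4) : E4 →L[ℝ] E4)))
    (hγ : ∀ t, |((Λ t : E4 ≃L[ℝ] E4) (E4.basisVector 0)) 0| ≤ γ)
    (hu : ∀ m, 1 ≤ m → m ≤ k → Tendsto (fun t ↦ iteratedDeriv m
      (fun s ↦ (Λ s : E4 ≃L[ℝ] E4) (E4.basisVector 0)) t) atTop (𝓝 0))
    (hs : ∀ m, 1 ≤ m → m ≤ k → Tendsto (fun t ↦ iteratedDeriv m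
      (fun s ↦ (Λ s : E4 ≃L[ℝ] E4) (E4.basisVector 3)) t) atTop (𝓝 0)) :
    ∃ θ : ℝ → ℝ, ContDiff ℝ ∞ θ ∧
      ContDiff ℝ ∞ (fun t ↦ (((Λ t * rotL (θ t) : lorentzGroup) : E4 ≃L[ℝ] E4) : E4 →L[ℝ] E4)) ∧
      ∀ m, 1 ≤ m → m ≤ k → Tendsto (fun t ↦ iteratedDeriv m
        (fun s ↦ (((Λ s * rotL (θ s) : lorentzGroup) : E4 ≃L[ℝ] E4) : E4 →L[ℝ] E4)) t)
        atTop (𝓝 0) := by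
  obtain ⟨θ, hθs, hFts, hc0, hc3, hode⟩ := exists_untwisting_angle' Λ hΛ
  -- the untwisted operator path and its columns
  set Ft : ℝ → E4 →L[ℝ] E4 :=
    fun t ↦ (((Λ t * rotL (θ t) : lorentzGroup) : E4 ≃L[ℝ] E4) : E4 →L[ℝ] E4) with hFt
  have hFtapp : ∀ t v, Ft t v = ((Λ t * rotL (θ t) : lorentzGroup) : E4 ≃L[ℝ] E4) v := fun _ _ ↦ rfl
  set u : ℝ → E4 := fun t ↦ (Λ t : E4 ≃L[ℝ] E4) (E4.basisVector 0) with hudef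
  set s : ℝ → E4 := fun t ↦ (Λ t : E4 ≃L[ℝ] E4) (E4.basisVector 3) with hsdef
  set p : ℝ → E4 := fun t ↦ Ft t (E4.basisVector 1) with hpdef
  set q : ℝ → E4 := fun t ↦ Ft t (E4.basisVector 2) with hqdef
  have hcol : ∀ v : E4, ContDiff ℝ ∞ fun t ↦ Ft t v := fun v ↦ hFts.clm_apply contDiff_const
  have hus : ContDiff ℝ ∞ u := hΛ.clm_apply contDiff_const
  have hss : ContDiff ℝ ∞ s := hΛ.clm_apply contDiff_const
  have hps : ContDiff ℝ ∞ p := hcol _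
  have hqs : ContDiff ℝ ∞ q := hcol _
  have c0 : (fun t ↦ Ft t (E4.basisVector 0)) = u := funext fun t ↦ hc0 t
  have c3 : (fun t ↦ Ft t (E4.basisVector 3)) = s := funext fun t ↦ hc3 t
  -- transport laws
  have hpode : ∀ t, deriv p t = (Minkowski.bilin (p t) (deriv u t)) • u t -
      (Minkowski.bilin (p t) (deriv s t)) • s t := fun t ↦ hode 1 (Or.inl rfl) t
  have hqode : ∀ t, deriv q t = (Minkowski.bilin (q t) (deriv u t)) • u t -
      (Minkowski.bilin (q t) (deriv s t)) • s t := fun t ↦ hode 2 (Or.inr rfl) t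
  -- uniform bounds on the columns (all columns of a Lorentz matrix with Lorentz factor `≤ γ`)
  set C : ℝ := 1 + 3 * γ with hC
  have hγt : ∀ t, |(((Λ t * rotL (θ t) : lorentzGroup) : E4 ≃L[ℝ] E4) (E4.basisVector 0)) 0| ≤ γ :=
    fun t ↦ by rw [hc0 t]; exact hγ t
  have hcoln : ∀ (L : lorentzGroup), |((L : E4 ≃L[ℝ] E4) (E4.basisVector 0)) 0| ≤ γ →
      ∀ μ : Fin 4, ‖(L : E4 ≃L[ℝ] E4) (E4.basisVector μ)‖ ≤ C := fun L hL μ ↦ by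
    have h1 := ((L : E4 ≃L[ℝ] E4) : E4 →L[ℝ] E4).le_opNorm (E4.basisVector μ)
    rw [show ‖(E4.basisVector μ : E4)‖ = 1 by simp, mul_one] at h1
    exact h1.trans ((norm_lorentz_le L).trans (by rw [hC]; linarith))
  have hub : ∀ t, ‖u t‖ ≤ C := fun t ↦ hcoln (Λ t) (hγ t) 0
  have hsb : ∀ t, ‖s t‖ ≤ C := fun t ↦ hcoln (Λ t) (hγ t) 3
  have hpb : ∀ t, ‖p t‖ ≤ C := fun t ↦ hcoln (Λ t * rotL (θ t)) (hγt t) 1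
  have hqb : ∀ t, ‖q t‖ ≤ C := fun t ↦ hcoln (Λ t * rotL (θ t)) (hγt t) 2
  -- transport decay for `p`, `q`
  have hp0 := tendsto_iteratedDeriv_of_transport' k hus hss hps hub hsb hpb hpode hu hs
  have hq0 := tendsto_iteratedDeriv_of_transport' k hus hss hqs hub hsb hqb hqode hu hs
  refine ⟨θ, hθs, hFts, fun m hm1 hmk ↦ ?_⟩
  refine tendsto_iteratedDeriv_clm_zero_of_columns hFts m fun μ ↦ ?_
  fin_cases μ
  · simp only [Fin.zero_eta, c0]; exact hu m hm1 hmk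
  · exact hp0 m hm1 hmk
  · exact hq0 m hm1 hmk
  · simp only [Fin.reduceFinMk, c3]; exact hs m hm1 hmk

/-- Registered sub-goal form (stub `exists_untwisted_frame` of the crux item) of
`exists_untwisted_frame'`: untwisting the painted frame of a rotating hole. [folklore] -/
theorem exists_untwisted_frame : open Literature.Geometry.Lorentzian Filter Topology Summit.FinalStateConjecture.FinalStateConjecture.Theorems.InertialRecession.Negative in ∀ (Λ : ℝ → lorentzGroup) (γ : ℝ) (k : ℕ), ContDiff ℝ ((⊤ : ℕ∞) : WithTop ℕ∞) (fun t ↦ ((Λ t : E4 ≃L[ℝ] E4) : E4 →L[ℝ] E4)) → (∀ t, |((Λ t : E4 ≃L[ℝ] E4) (E4.basisVector 0)) 0| ≤ γ) → (∀ m : ℕ, 1 ≤ m → m ≤ k → Tendsto (fun t ↦ iteratedDeriv m (fun s ↦ (((Λ s : lorentzGroup) : E4 ≃L[ℝ] E4) (E4.basisVector 0))) t) atTop (𝓝 0)) → (∀ m : ℕ, 1 ≤ m → m ≤ k → Tendsto (fun t ↦ iteratedDeriv m (fun s ↦ (((Λ s : lorentzGroup) : E4 ≃L[ℝ] E4) (E4.basisVector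 3))) t) atTop (𝓝 0)) → ∃ θ : ℝ → ℝ, ContDiff ℝ ((⊤ : ℕ∞) : WithTop ℕ∞) θ ∧ ContDiff ℝ ((⊤ : ℕ∞) : WithTop ℕ∞) (fun t ↦ (((Λ t * rotL (θ t) : lorentzGroup) : E4 ≃L[ℝ] E4) : E4 →L[ℝ] E4)) ∧ ∀ m : ℕ, 1 ≤ m → m ≤ k → Tendsto (fun t ↦ iteratedDeriv m (fun s ↦ (((Λ s * rotL (θ s) : lorentzGroup) : E4 ≃L[ℝ] E4) : E4 →L[ℝ] E4)) t) atTop (𝓝 0) :=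
  fun Λ γ k hΛ hγ hu hs ↦ exists_untwisted_frame' Λ γ k hΛ hγ hu hs

end Summit.FinalStateConjecture.FinalStateConjecture.Theorems.SublinearIsFree.Rechart

end
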